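import Mathlib.NumberTheory.LSeries.RiemannZeta
import Literature.NumberTheory.LFunctions.RHWave0
import Literature.NumberTheory.LFunctions.GeneralizedRH
import Literature.NumberTheory.LFunctions.DedekindZeta
import Literature.NumberTheory.LFunctions.SelbergClass
import HarnessLib

-- provenance: harness21/H21/H21/Statements/RH/GeneralizedRH.lean @ 7998fb0 (interim HEAD d8f2665); M5 mechanical rewrite
/-!
# Extended and Grand Riemann Hypotheses (family RH; AntSieve outline §3)

Target statements **rh.S03** (Extended Riemann Hypothesis for Dedekind zeta functions) and
**rh.S05** (Grand Riemann Hypothesis for the Selberg class), together with the bridge from the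
global GRH `Literature.NumberTheory.LFunctions.GeneralizedRiemannHypothesis` (rh.S02, `Statements/RH/Wave0`, *not* redefined
here) to the per-character predicate `DirichletCharacter.RiemannHypothesis` of the AntSieve prelude,
and the standard implications `Selberg GRH ⇒ ERH ⇒ GRH ⇒ RH`.

All hypotheses are in the uniform *strip form* `F s = 0 → 0 < re s → re s < 1 → re s = 1/2`
(outline D-ANT-5). The `Prop`s themselves are prelude definitions:
`Literature.NumberTheory.LFunctions.ExtendedRiemannHypothesis` (`Prelude/AntSieve/DedekindZeta`),
`Literature.NumberTheory.LFunctions.SelbergGrandRiemannHypothesis` (`Prelude/AntSieve/SelbergClass`); this file records the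
statement ids on unfolding lemmas (`erh_iff`, `selbergGrandRiemannHypothesis_iff`) exactly as
`Wave0` does for Mathlib's `RiemannHypothesis`.

Mathlib anchors: `RiemannHypothesis`, `riemannZeta`, `DirichletCharacter.LFunction`,
`DirichletCharacter.primitiveCharacter`, `DirichletCharacter.primitiveCharacter_isPrimitive`,
`DirichletCharacter.LFunction_modOne_eq`. Mathlib has no ERH / Selberg-class GRH (searched
`ExtendedRiemann`, `GrandRiemann`, `SelbergClass`).

Design notes.
* `ExtendedRiemannHypothesis.riemannHypothesis : ERH → RiemannHypothesis` already exists in the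
  prelude (`Prelude/AntSieve/DedekindZeta`); it is re-exported here in strip form as
  `ExtendedRiemannHypothesis.riemannHypothesisStrip` rather than redeclared.
* Membership of `ζ_K` in the Selberg class is recorded as the existence theorem
  `exists_selbergDatum_dedekindZetaCont` (like `exists_selbergDatum_riemannZeta` in the prelude),
  from which `SelbergGrandRiemannHypothesis.extendedRiemannHypothesis` follows formally.

References: H. Iwaniec, E. Kowalski, *Analytic Number Theory* (2004), §5.7 and Conjecture 5.7
("Grand Riemann Hypothesis"), §5.10 (Dedekind zeta functions); S. Lang, *Algebraic Number Theory*,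
ch. XIII; A. Selberg, *Old and new conjectures and results about a class of Dirichlet series*
(Amalfi 1989), Salerno 1992; J. Kaczorowski, A. Perelli, *The Selberg class: a survey* (1999);
H. Davenport, *Multiplicative Number Theory*, ch. 20; L. Washington, *Introduction to Cyclotomic
Fields*, Thm. 4.3 (`ζ_{ℚ(ζ_N)} = ∏_χ L(s, χ⋆)`).
-/

noncomputable section

open Complex

namespace Literature.NumberTheory.LFunctions

/-! ## GRH for Dirichlet `L`-functions: bridge to the per-character predicate -/

/-! ## rh.S03: the Extended Riemann Hypothesis -/

/-- **rh.S03** (Extended Riemann Hypothesis; Iwaniec–Kowalski, *Analytic Number Theory*,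
Conjecture 5.7 (Dedekind case) and §5.10; Lang, *Algebraic Number Theory*, ch. XIII). For every
number field `K`, every zero of the continued Dedekind zeta function `ζ_K = dedekindZetaCont K` in
the open critical strip `0 < re s < 1` lies on the critical line `re s = 1/2`. The `Prop` is the
prelude's `Literature.NumberTheory.LFunctions.ExtendedRiemannHypothesis`; this lemma unfolds it. Open. [folklore] -/
theorem erh_iff :
    ExtendedRiemannHypothesis ↔
      ∀ (K : Type) [Field K] [NumberField K] (s : ℂ),
        dedekindZetaCont K s = 0 → 0 < s.re → s.re < 1 → s.re = 1 / 2 :=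
  Iff.rfl

/-- ERH in continuation-agnostic form: for every number field `K` and *every* continuation `F` of
the Dirichlet series `ζ_K` to `ℂ ∖ {1}` (`IsDedekindZetaContinuation K F`), the zeros of `F` in
the open critical strip lie on `re s = 1/2`. Equivalent to `ExtendedRiemannHypothesis` by
existence (Hecke 1917) and uniqueness of the continuation
(`NumberField.extendedRiemannHypothesis_iff'`; Iwaniec–Kowalski §5.10).
[cite: HeckeZeta1917, Hauptsatz] [cite: IwaniecKowalski2004, §5.10] -/
def erh_iff' : Prop :=
  ExtendedRiemannHypothesis ↔
      ∀ (K : Type) [Field K] [NumberField K] (F : ℂ → ℂ), IsDedekindZetaContinuation K F →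
        ∀ s : ℂ, F s = 0 → 0 < s.re → s.re < 1 → s.re = 1 / 2

/- interim proof relied on results that are now named facts (D-0014); demoted to a fact by the M5
import, proof preserved:
:=
  forall₃_congr fun K _ _ ↦ NumberField.extendedRiemannHypothesis_iff' K
-/

/-- ERH implies the strip form of the Riemann Hypothesis (case `K = ℚ`:
`dedekindZetaCont ℚ = riemannZeta` off `s = 1`, prelude `extendedRiemannHypothesis_rat_iff`;
the `RiemannHypothesis`-valued version is the prelude's
`ExtendedRiemannHypothesis.riemannHypothesis`). Iwaniec–Kowalski §5.10.
[cite: IwaniecKowalski2004, §5.10] -/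
def ExtendedRiemannHypothesis.riemannHypothesisStrip : Prop :=
  ∀ (h : ExtendedRiemannHypothesis),
    RiemannHypothesisStrip

/- interim proof relied on results that are now named facts (D-0014); demoted to a fact by the M5
import, proof preserved:
:=
  riemannHypothesis_iff_strip.mp h.riemannHypothesis
-/

/-- ERH implies GRH for Dirichlet `L`-functions: for the cyclotomic field `K = ℚ(ζ_N)` one has
`ζ_K(s) = ∏_{χ mod N} L(s, χ⋆)` (product over the primitive characters inducing the characters
mod `N`; Washington, *Introduction to Cyclotomic Fields*, Thm. 4.3), so a zero of `L(s, χ)` in the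
open strip is a zero of `ζ_K` (`DirichletCharacter.riemannHypothesis_iff_primitiveCharacter`).
Davenport ch. 20; Iwaniec–Kowalski §5.10. [cite: Washington1997, Thm. 4.3]
[cite: DavenportMNT1980, Ch. 20] -/
def ExtendedRiemannHypothesis.generalizedRiemannHypothesis : Prop :=
  ∀ (h : ExtendedRiemannHypothesis),
    Literature.NumberTheory.LFunctions.GeneralizedRiemannHypothesis

/-! ## rh.S05: the Grand Riemann Hypothesis for the Selberg class -/

/-- **rh.S05** (Grand Riemann Hypothesis for the Selberg class; Selberg 1992 (Amalfi),
Conjecture; Kaczorowski–Perelli, *The Selberg class: a survey*, §1; Iwaniec–Kowalski Conj. 5.7).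
Every `F` in the Selberg class `𝒮` — a Dirichlet series `∑ a(n) n⁻ˢ` with `a(1) = 1` satisfying
(i) the Ramanujan bound `a(n) ≪_ε n^ε`, (ii) analytic continuation of `(s-1)^m F(s)` to an entire
function of finite order, (iii) a functional equation `Φ(s) = ω conj Φ(1 - conj s)` for
`Φ(s) = Q^s ∏ⱼ Γ(λⱼ s + μⱼ) F(s)` with `Q > 0`, `λⱼ > 0`, `re μⱼ ≥ 0`, `‖ω‖ = 1`, and
(iv)–(v) an Euler product `log F(s) = ∑ b(n) n⁻ˢ`, `b` supported on prime powers, `b(n) ≪ n^θ`,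
`θ < 1/2` (bundled as `Literature.NumberTheory.LFunctions.SelbergDatum`) — has all its zeros in the open critical strip
`0 < re s < 1` on the line `re s = 1/2`. The `Prop` is the prelude's
`Literature.NumberTheory.LFunctions.SelbergGrandRiemannHypothesis`; this lemma unfolds it. Open.
[cite: SelbergAmalfi1992, §1] [cite: KaczorowskiPerelli1999, §1] -/
theorem selbergGrandRiemannHypothesis_iff :
    SelbergGrandRiemannHypothesis ↔
      ∀ (D : SelbergDatum) (s : ℂ), D.toFun s = 0 → 0 < s.re → s.re < 1 → s.re = 1 / 2 :=
  Iff.rfl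

/-- The Grand Riemann Hypothesis for the Selberg class implies GRH for Dirichlet `L`-functions:
reduce to the inducing primitive character (`riemannHypothesis_iff_primitiveCharacter`), which is
either the character mod `1` (`L = ζ ∈ 𝒮`) or a primitive character of conductor `> 1`
(`L(s, χ⋆) ∈ 𝒮`, prelude `exists_selbergDatum_LFunction`). Kaczorowski–Perelli survey, §1;
Davenport ch. 20. [cite: KaczorowskiPerelli1999, §1] -/
def SelbergGrandRiemannHypothesis.generalizedRiemannHypothesis : Prop :=
  ∀ (h : SelbergGrandRiemannHypothesis),
    Literature.NumberTheory.LFunctions.GeneralizedRiemannHypothesis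

/- interim proof relied on results that are now named facts (D-0014); demoted to a fact by the M5
import, proof preserved:
:= by
  -- primitive characters of any modulus `M`
  have key : ∀ (M : ℕ) [NeZero M] (ψ : DirichletCharacter ℂ M), ψ.IsPrimitive →
      ψ.RiemannHypothesis := by
    intro M _ ψ hψ
    by_cases hM : M = 1
    · subst hM
      intro s hs
      rw [DirichletCharacter.LFunction_modOne_eq] at hs
      exact riemannHypothesis_iff_strip.mp h.riemannHypothesis s hs
    · exact SelbergGrandRiemannHypothesis.lFunction_re_eq_one_half ψ hψ hM h
  rw [generalizedRiemannHypothesis_iff]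
  intro N _ χ
  rw [DirichletCharacter.riemannHypothesis_iff_primitiveCharacter]
  haveI : NeZero χ.conductor := ⟨χ.conductor_ne_zero⟩
  exact key _ _ (DirichletCharacter.primitiveCharacter_isPrimitive χ)
-/

/-- The Dedekind zeta function of a number field `K` belongs to the Selberg class, with degree
`[K : ℚ]` and a simple pole at `s = 1`: one may take `m = 1`, `Q = |d_K|^{1/2} π^{-[K:ℚ]/2}
2^{-r₂}`, `r₁ + r₂` gamma factors `Γ(s/2)` and `r₂` gamma factors `Γ((s+1)/2)` (Legendre
duplication applied to `Γ_ℂ`), `ω = 1`, and `b(n) = #{𝔭, k | N(𝔭)ᵏ = n}/k`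
(Kaczorowski–Perelli survey, §1, Example 3; Neukirch, *ANT* Cor. VII.5.10). Stated as an
existence theorem (cf. `exists_selbergDatum_riemannZeta`); the value of `dedekindZetaCont K` at
`s = 1` is junk, but `SelbergDatum.toFun` is unconstrained there, so equality of functions is the
right statement. [cite: KaczorowskiPerelli1999, §1 (examples of members of the Selberg class)]
[cite: NeukirchANT1999, Cor. VII.5.10] -/
def exists_selbergDatum_dedekindZetaCont : Prop :=
  ∀ (K : Type) [Field K] [NumberField K],
    ∃ D : SelbergDatum, D.toFun = dedekindZetaCont K ∧
      D.degree = Module.finrank ℚ K ∧ D.polarOrder = 1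

/-- The Grand Riemann Hypothesis for the Selberg class implies the Extended Riemann Hypothesis
(`ζ_K ∈ 𝒮`, `exists_selbergDatum_dedekindZetaCont`; Kaczorowski–Perelli survey, §1).
[cite: KaczorowskiPerelli1999, §1] -/
def SelbergGrandRiemannHypothesis.extendedRiemannHypothesis : Prop :=
  ∀ (h : SelbergGrandRiemannHypothesis),
    ExtendedRiemannHypothesis

/- interim proof relied on results that are now named facts (D-0014); demoted to a fact by the M5
import, proof preserved:
:= by
  intro K _ _ s hs h₀ h₁
  obtain ⟨D, hD, -, -⟩ := exists_selbergDatum_dedekindZetaCont K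
  exact h D s (by rw [hD]; exact hs) h₀ h₁
-/

/-! ## Conditional discharges (D-0014: the inputs are named facts of the imported files) -/

/-- `ExtendedRiemannHypothesis.riemannHypothesisStrip` from the prelude facts
`riemannHypothesis_iff_strip` and `ExtendedRiemannHypothesis.riemannHypothesis`.
[cite: IwaniecKowalski2004, §5.10] -/
theorem ExtendedRiemannHypothesis.riemannHypothesisStrip_of
    (hstrip : riemannHypothesis_iff_strip) (hrh : ExtendedRiemannHypothesis.riemannHypothesis) :
    ExtendedRiemannHypothesis.riemannHypothesisStrip :=
  fun h ↦ hstrip.mp (hrh h)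

/-- `SelbergGrandRiemannHypothesis.extendedRiemannHypothesis` from membership of `ζ_K` in the
Selberg class (`exists_selbergDatum_dedekindZetaCont`). [cite: KaczorowskiPerelli1999, §1] -/
theorem SelbergGrandRiemannHypothesis.extendedRiemannHypothesis_of
    (hK : exists_selbergDatum_dedekindZetaCont) :
    SelbergGrandRiemannHypothesis.extendedRiemannHypothesis := by
  intro h K _ _ s hs h₀ h₁
  obtain ⟨D, hD, -, -⟩ := hK K
  exact h D s (by rw [hD]; exact hs) h₀ h₁

end Literature.NumberTheory.LFunctions

end
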